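import Summits.BirchSwinnertonDyer.BirchSwinnertonDyer.Theorems.ByReductionTypeAtTwoFineSelmerConjAAtTwoAdditivePotGoodTwoLayerDoorFukudaRows
import Summits.BirchSwinnertonDyer.BirchSwinnertonDyer.Theorems.ByReductionTypeAtTwoFineSelmerConjAAtTwoAdditivePotGoodClassNumberOne780
import HarnessLib

/-!
# Route `ByReductionTypeAtTwo` (rung K4), crux C1″ `FineSelmerConjAAtTwoAdditivePotGood` (item stmt-BirchSwinnertonDyer-22615):
# FUKUDA-ROW STAMPS, part E — census rows `194140b1` (`d = -2284`), `98592q1` (`d = -4108`), `433336a1` (`d = -54167`), `294104f1` (`d = -36763`) (EVEN class number of the cubic point field): (A)₂ modulo `hLim2` and ONE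
# displayed numeric equality (`ord₂ h(F(√2)) = ord₂ h(F)` resp. equal `2`-ranks), Fukuda's index `0` being KERNEL
# (a `--supports 22615` file; seat `bsd-2adic-k4-w1` GEN 5; consumers of `…TwoLayerDoorFukudaRows`)

HONEST FRAMING (cell `bsd-2adic`, D-0036/D-0054/D-0152): per-class stamps; conditional on `hLim2` (Lim 2017 Thm. 3.5 at `2`) BY NAME and on ONE
displayed numeric equality per row about the first two layers of the cyclotomic `ℤ₂`-tower of `ℚ(θ)` (census columns `cyc3/cyc6` of
`addL2x/gen5/conjA2_census_j289938_classes.tsv`, PARI — NOT kernel). These rows have EVEN `h(F)`, so neither Iwasawa 1956 nor the two-layer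
door with `e₀ = 0` applies; k4-w2 GEN 3's `bsdp_two_<L>_of_fukudaCertificate_pointField` displayed `hcert` = «`TotallyRamifiedFrom κL n₀` ∧
equal `2`-ranks» — the FIRST conjunct is now KERNEL (`n₀ = 0`: odd discriminant / one prime above `2` / even-index certificate), so the
row's (A)₂ hangs on ONE decidable class-group equality. KERNEL: irreducibility, `ℚ(P) = ℚ(θ)` (explicit change of generator), the
discharge of `n₀ = 0`, Fukuda Thm. 1 (`_holds`). Closes nothing at the `∀`-level; nothing booked; BSD is not proved by any of this.

THE FIELDS: `d = -2284`: `X³ + (-2)X² + (-16)X + (-18)`; `d = -4108`: `X³ + (0)X² + (10)X + (-2)`; `d = -54167`: `X³ + (-1)X² + (-38)X + (-89)`; `d = -36763`: `X³ + (-1)X² + (-59)X + (-160)`.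

References: [Fukuda1994] Thm. 1 (1)(2); [Lim2017FineSelmer] Thm. 3.5, Lemma 3.2; [CoatesSujatha2005] (A); [Marcus1977] Ch. 2;
cell TSV `addL2x/gen5/conjA2_census_j289938_classes.tsv`.
-/

set_option autoImplicit false
-- sibling precedent (`…TwoLayerDoorFukudaRows.lean`): the directory name repeats the summit name
set_option linter.dupNamespace false

noncomputable section

open scoped Classical IntermediateField NumberField Real nonZeroDivisors

namespace Summit.BirchSwinnertonDyer.BirchSwinnertonDyer.Theorems.AddKatoTwo

open WeierstrassCurve Field Polynomial IsDedekindDomain NumberField Matrix Literature.NumberTheory.EllipticCurves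
  Literature.NumberTheory.GaloisRepresentations
  Literature.NumberTheory.IwasawaTheory
  Summit.BirchSwinnertonDyer.BirchSwinnertonDyer.Theorems.AlignedTransportAtTwoTorsionPointField
  Summit.BirchSwinnertonDyer.BirchSwinnertonDyer.Theses.ByReductionTypeAtTwo

/-! ## §1 Irreducibility of the models -/

/-- `X³ + (-2)X² + (-16)X + (-18)` (a model of the cubic field of discriminant `-2284`) is irreducible over `ℚ` (no root mod `11`). -/
theorem irreducible_cubic_d2284n : Irreducible (Cubic.toPoly ⟨1, ((-2 : ℤ) : ℚ), ((-16 : ℤ) : ℚ), ((-18 : ℤ) : ℚ)⟩) :=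
  haveI : Fact (Nat.Prime 11) := ⟨by norm_num⟩
  irreducible_cubic_of_no_root_zmod 11 (by decide)

/-- `X³ + (0)X² + (10)X + (-2)` (a model of the cubic field of discriminant `-4108`) is irreducible over `ℚ` (no root mod `7`). -/
theorem irreducible_cubic_d4108n : Irreducible (Cubic.toPoly ⟨1, ((0 : ℤ) : ℚ), ((10 : ℤ) : ℚ), ((-2 : ℤ) : ℚ)⟩) :=
  haveI : Fact (Nat.Prime 7) := ⟨by norm_num⟩
  irreducible_cubic_of_no_root_zmod 7 (by decide)

/-- `X³ + (-1)X² + (-38)X + (-89)` (a model of the cubic field of discriminant `-54167`) is irreducible over `ℚ` (no root mod `3`). -/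
theorem irreducible_cubic_d54167n : Irreducible (Cubic.toPoly ⟨1, ((-1 : ℤ) : ℚ), ((-38 : ℤ) : ℚ), ((-89 : ℤ) : ℚ)⟩) :=
  haveI : Fact (Nat.Prime 3) := ⟨by norm_num⟩
  irreducible_cubic_of_no_root_zmod 3 (by decide)

/-- `X³ + (-1)X² + (-59)X + (-160)` (a model of the cubic field of discriminant `-36763`) is irreducible over `ℚ` (no root mod `7`). -/
theorem irreducible_cubic_d36763n : Irreducible (Cubic.toPoly ⟨1, ((-1 : ℤ) : ℚ), ((-59 : ℤ) : ℚ), ((-160 : ℤ) : ℚ)⟩) :=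
  haveI : Fact (Nat.Prime 7) := ⟨by norm_num⟩
  irreducible_cubic_of_no_root_zmod 7 (by decide)

/-! ## §2 The stamps -/

/-- The census curve `194140b1` is an elliptic curve. -/
theorem isElliptic_194140b1' : (⟨0, ((-1 : ℤ) : ℚ), 0, ((-3712423301 : ℤ) : ℚ), ((-87062743809199 : ℤ) : ℚ)⟩ : WeierstrassCurve ℚ).IsElliptic :=
  isElliptic_cubicModel _ _ _ (by simp only [Cubic.discr]; norm_num)

/-- **(A)₂ for `194140b1` from Fukuda's two-layer criterion with `n₀ = 0` DISCHARGED — ONE displayed numeric equality** (a `C1″-RES` row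
with EVEN `h(ℚ(P))`, `d = -2284`; k4-w2's `bsdp_two_194140b1_of_fukudaCertificate_pointField` displayed the two-conjunct `hcert`). Granted
`hLim2`; displayed: `ord₂ h(ℚ(θ, √2)) = ord₂ h(ℚ(θ))` (census `cyc3 = [2]`, `cyc6 = [2]`), `θ` any root of `X³ + (-2)X² + (-16)X + (-18)`. KERNEL: `ℚ(P) = ℚ(β) = ℚ(θ)`
(`β = -28385 + (7100)θ + (1971)θ²` a root of the `2`-division cubic), Fukuda's index `0` from ONE prime above `2` (Eisenstein model, `existsUnique_two_mem_adjoin_of_eisenstein`; its index divides `3`), Fukuda Thm. 1 (1) (`_holds`).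
[cite: Lim2017FineSelmer, §3 Thm. 3.5 and Lemma 3.2] [cite: Fukuda1994, Thm. 1 (1), p. 264] -/
theorem conjA_two_194140b1_of_fukudaLayers
    (hLim2 : Lim2017.thm35_at_two_fineSelmerDual_moduleFinite_of_classicalMuVanishes_of_le_divisionField_four)
    {θ : AlgebraicClosure ℚ} (hθ : aeval θ (Cubic.toPoly ⟨1, ((-2 : ℤ) : ℚ), ((-16 : ℤ) : ℚ), ((-18 : ℤ) : ℚ)⟩) = 0)
    (h01 : haveI : FiniteDimensional ℚ (IntermediateField.adjoin ℚ {θ}) :=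
        IntermediateField.adjoin.finiteDimensional ((AlgebraicClosure.isAlgebraic ℚ).isAlgebraic θ).isIntegral
      haveI : NumberField (IntermediateField.adjoin ℚ {θ}) := NumberField.mk
      ∀ κL : ZpExtension (IntermediateField.adjoin ℚ {θ}) 2, κL.IsCyclotomic → classNumberPExp κL 1 = classNumberPExp κL 0)
    (κ : ZpExtension ℚ 2) (hκ : κ.IsCyclotomic) :
    haveI := isElliptic_194140b1'
    ∃ (γ : absoluteGaloisGroup ℚ) (D : (⟨0, ((-1 : ℤ) : ℚ), 0, ((-3712423301 : ℤ) : ℚ), ((-87062743809199 : ℤ) : ℚ)⟩ : WeierstrassCurve ℚ).FineSelmerDualData κ γ),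
      Module.Finite ℤ_[2] (RestrictScalars ℤ_[2] (IwasawaAlgebra 2) D.X) := by
  haveI := isElliptic_194140b1'
  have hθ' : θ ^ 3 + (-2 : AlgebraicClosure ℚ) * θ ^ 2 + (-16 : AlgebraicClosure ℚ) * θ + (-18 : AlgebraicClosure ℚ) = 0 := by
    have := hθ
    simp only [Cubic.toPoly, map_one, one_mul, aeval_add, aeval_mul, aeval_C, aeval_X_pow, aeval_X,
      eq_ratCast, Rat.cast_intCast] at this
    push_cast at this
    linear_combination this
  set β : AlgebraicClosure ℚ := algebraMap ℚ (AlgebraicClosure ℚ) (-28385 : ℚ) +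
      algebraMap ℚ (AlgebraicClosure ℚ) (7100 : ℚ) * θ + algebraMap ℚ (AlgebraicClosure ℚ) (1971 : ℚ) * θ ^ 2 with hβdef
  have hβ : aeval β (Cubic.toPoly ⟨1, ((-1 : ℤ) : ℚ), ((-3712423301 : ℤ) : ℚ), ((-87062743809199 : ℤ) : ℚ)⟩) = 0 := by
    simp only [Cubic.toPoly, map_one, one_mul, aeval_add, aeval_mul, aeval_C, aeval_X_pow, aeval_X, eq_ratCast,
      Rat.cast_intCast]
    rw [hβdef]
    simp only [eq_ratCast]
    push_cast
    linear_combination ((253135671398 : AlgebraicClosure ℚ) + (285891468624 : AlgebraicClosure ℚ) * θ + (98061156522 : AlgebraicClosure ℚ) * θ ^ 2 + (7657021611 : AlgebraicClosure ℚ) * θ ^ 3) * hθ'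
  have hadj : IntermediateField.adjoin ℚ {β} = IntermediateField.adjoin ℚ {θ} := by
    apply le_antisymm
    · rw [IntermediateField.adjoin_simple_le_iff, hβdef]
      have hθmem := IntermediateField.mem_adjoin_simple_self ℚ θ
      exact add_mem (add_mem (algebraMap_mem _ _) (mul_mem (algebraMap_mem _ _) hθmem))
        (mul_mem (algebraMap_mem _ _) (pow_mem hθmem 2))
    · rw [IntermediateField.adjoin_simple_le_iff]
      have hθeq : θ = algebraMap ℚ (AlgebraicClosure ℚ) (4905769425821/41503906250 : ℚ) +
          algebraMap ℚ (AlgebraicClosure ℚ) (1443791/830078125 : ℚ) * β +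
          algebraMap ℚ (AlgebraicClosure ℚ) (-1971/41503906250 : ℚ) * β ^ 2 := by
        rw [hβdef]; simp only [eq_ratCast]; push_cast
        linear_combination (((35239392711 : AlgebraicClosure ℚ) / 20751953125) + ((7657021611 : AlgebraicClosure ℚ) / 41503906250) * θ) * hθ'
      rw [hθeq]
      have hβmem := IntermediateField.mem_adjoin_simple_self ℚ β
      exact add_mem (add_mem (algebraMap_mem _ _) (mul_mem (algebraMap_mem _ _) hβmem))
        (mul_mem (algebraMap_mem _ _) (pow_mem hβmem 2))
  obtain ⟨P₀, hP₀, hP₀eq⟩ := exists_geomTorsion_two_eq_some_root ((-1 : ℤ) : ℚ) ((-3712423301 : ℤ) : ℚ)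
    ((-87062743809199 : ℤ) : ℚ) hβ
  have hF : IntermediateField.fixedField (MulAction.stabilizer (absoluteGaloisGroup ℚ) P₀) =
      IntermediateField.adjoin ℚ {θ} := by
    rw [fixedField_stabilizer_eq_adjoin_root _ _ _ hβ hP₀eq, ← hadj]
    -- the two `Algebra ℚ ℚ̄` instance paths agree
    congr 1
  have hirr := irreducible_cubic_d2284n
  exact fineSelmerDual_moduleFinite_two_of_totallyRamified_of_succ_eq_pointField hLim2 _ hP₀ hF
    (forall_totallyRamifiedFrom_zero_adjoin_of_existsUnique_two_mem (p := -2) (q := -16) (r := -18) hirr hθ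
      (existsUnique_two_mem_adjoin_of_eisenstein (p := -2) (q := -16) (r := -18) (by decide) (by decide) (by decide) (by decide) hθ))
    h01 κ hκ

/-- The census curve `98592q1` is an elliptic curve. -/
theorem isElliptic_98592q1' : (⟨0, ((-1 : ℤ) : ℚ), 0, ((-195347181 : ℤ) : ℚ), ((-1770320388987 : ℤ) : ℚ)⟩ : WeierstrassCurve ℚ).IsElliptic :=
  isElliptic_cubicModel _ _ _ (by simp only [Cubic.discr]; norm_num)

/-- **(A)₂ for `98592q1` from Fukuda's two-layer criterion with `n₀ = 0` DISCHARGED — ONE displayed numeric equality** (a `C1″-RES` row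
with EVEN `h(ℚ(P))`, `d = -4108`; k4-w2's `bsdp_two_98592q1_of_fukudaCertificate_pointField` displayed the two-conjunct `hcert`). Granted
`hLim2`; displayed: `ord₂ h(ℚ(θ, √2)) = ord₂ h(ℚ(θ))` (census `cyc3 = [2]`, `cyc6 = [2]`), `θ` any root of `X³ + (0)X² + (10)X + (-2)`. KERNEL: `ℚ(P) = ℚ(β) = ℚ(θ)`
(`β = 17387 + (-1154)θ + (2608)θ²` a root of the `2`-division cubic), Fukuda's index `0` from ONE prime above `2` (Eisenstein model, `existsUnique_two_mem_adjoin_of_eisenstein`; its index divides `3`), Fukuda Thm. 1 (1) (`_holds`).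
[cite: Lim2017FineSelmer, §3 Thm. 3.5 and Lemma 3.2] [cite: Fukuda1994, Thm. 1 (1), p. 264] -/
theorem conjA_two_98592q1_of_fukudaLayers
    (hLim2 : Lim2017.thm35_at_two_fineSelmerDual_moduleFinite_of_classicalMuVanishes_of_le_divisionField_four)
    {θ : AlgebraicClosure ℚ} (hθ : aeval θ (Cubic.toPoly ⟨1, ((0 : ℤ) : ℚ), ((10 : ℤ) : ℚ), ((-2 : ℤ) : ℚ)⟩) = 0)
    (h01 : haveI : FiniteDimensional ℚ (IntermediateField.adjoin ℚ {θ}) :=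
        IntermediateField.adjoin.finiteDimensional ((AlgebraicClosure.isAlgebraic ℚ).isAlgebraic θ).isIntegral
      haveI : NumberField (IntermediateField.adjoin ℚ {θ}) := NumberField.mk
      ∀ κL : ZpExtension (IntermediateField.adjoin ℚ {θ}) 2, κL.IsCyclotomic → classNumberPExp κL 1 = classNumberPExp κL 0)
    (κ : ZpExtension ℚ 2) (hκ : κ.IsCyclotomic) :
    haveI := isElliptic_98592q1'
    ∃ (γ : absoluteGaloisGroup ℚ) (D : (⟨0, ((-1 : ℤ) : ℚ), 0, ((-195347181 : ℤ) : ℚ), ((-1770320388987 : ℤ) : ℚ)⟩ : WeierstrassCurve ℚ).FineSelmerDualData κ γ),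
      Module.Finite ℤ_[2] (RestrictScalars ℤ_[2] (IwasawaAlgebra 2) D.X) := by
  haveI := isElliptic_98592q1'
  have hθ' : θ ^ 3 + (0 : AlgebraicClosure ℚ) * θ ^ 2 + (10 : AlgebraicClosure ℚ) * θ + (-2 : AlgebraicClosure ℚ) = 0 := by
    have := hθ
    simp only [Cubic.toPoly, map_one, one_mul, aeval_add, aeval_mul, aeval_C, aeval_X_pow, aeval_X,
      eq_ratCast, Rat.cast_intCast] at this
    push_cast at this
    linear_combination this
  set β : AlgebraicClosure ℚ := algebraMap ℚ (AlgebraicClosure ℚ) (17387 : ℚ) +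
      algebraMap ℚ (AlgebraicClosure ℚ) (-1154 : ℚ) * θ + algebraMap ℚ (AlgebraicClosure ℚ) (2608 : ℚ) * θ ^ 2 with hβdef
  have hβ : aeval β (Cubic.toPoly ⟨1, ((-1 : ℤ) : ℚ), ((-195347181 : ℤ) : ℚ), ((-1770320388987 : ℤ) : ℚ)⟩) = 0 := by
    simp only [Cubic.toPoly, map_one, one_mul, aeval_add, aeval_mul, aeval_C, aeval_X_pow, aeval_X, eq_ratCast,
      Rat.cast_intCast]
    rw [hβdef]
    simp only [eq_ratCast]
    push_cast
    linear_combination ((-44550523400 : AlgebraicClosure ℚ) + (187806743104 : AlgebraicClosure ℚ) * θ + (-23547360768 : AlgebraicClosure ℚ) * θ ^ 2 + (17738739712 : AlgebraicClosure ℚ) * θ ^ 3) * hθ'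
  have hadj : IntermediateField.adjoin ℚ {β} = IntermediateField.adjoin ℚ {θ} := by
    apply le_antisymm
    · rw [IntermediateField.adjoin_simple_le_iff, hβdef]
      have hθmem := IntermediateField.mem_adjoin_simple_self ℚ θ
      exact add_mem (add_mem (algebraMap_mem _ _) (mul_mem (algebraMap_mem _ _) hθmem))
        (mul_mem (algebraMap_mem _ _) (pow_mem hθmem 2))
    · rw [IntermediateField.adjoin_simple_le_iff]
      have hθeq : θ = algebraMap ℚ (AlgebraicClosure ℚ) (-28302969251/9625456854 : ℚ) +
          algebraMap ℚ (AlgebraicClosure ℚ) (-6001417/28876370562 : ℚ) * β +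
          algebraMap ℚ (AlgebraicClosure ℚ) (326/14438185281 : ℚ) * β ^ 2 := by
        rw [hβdef]; simp only [eq_ratCast]; push_cast
        linear_combination (((1962280064 : AlgebraicClosure ℚ) / 14438185281) + ((-2217342464 : AlgebraicClosure ℚ) / 14438185281) * θ) * hθ'
      rw [hθeq]
      have hβmem := IntermediateField.mem_adjoin_simple_self ℚ β
      exact add_mem (add_mem (algebraMap_mem _ _) (mul_mem (algebraMap_mem _ _) hβmem))
        (mul_mem (algebraMap_mem _ _) (pow_mem hβmem 2))
  obtain ⟨P₀, hP₀, hP₀eq⟩ := exists_geomTorsion_two_eq_some_root ((-1 : ℤ) : ℚ) ((-195347181 : ℤ) : ℚ)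
    ((-1770320388987 : ℤ) : ℚ) hβ
  have hF : IntermediateField.fixedField (MulAction.stabilizer (absoluteGaloisGroup ℚ) P₀) =
      IntermediateField.adjoin ℚ {θ} := by
    rw [fixedField_stabilizer_eq_adjoin_root _ _ _ hβ hP₀eq, ← hadj]
    -- the two `Algebra ℚ ℚ̄` instance paths agree
    congr 1
  have hirr := irreducible_cubic_d4108n
  exact fineSelmerDual_moduleFinite_two_of_totallyRamified_of_succ_eq_pointField hLim2 _ hP₀ hF
    (forall_totallyRamifiedFrom_zero_adjoin_of_existsUnique_two_mem (p := 0) (q := 10) (r := -2) hirr hθ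
      (existsUnique_two_mem_adjoin_of_eisenstein (p := 0) (q := 10) (r := -2) (by decide) (by decide) (by decide) (by decide) hθ))
    h01 κ hκ

/-- The census curve `433336a1` is an elliptic curve. -/
theorem isElliptic_433336a1' : (⟨0, ((0 : ℤ) : ℚ), 0, ((-230659 : ℤ) : ℚ), ((-42638677 : ℤ) : ℚ)⟩ : WeierstrassCurve ℚ).IsElliptic :=
  isElliptic_cubicModel _ _ _ (by simp only [Cubic.discr]; norm_num)

/-- **(A)₂ for `433336a1` from Fukuda's two-layer criterion with `n₀ = 0` DISCHARGED — ONE displayed numeric equality** (a `C1″-RES` row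
with EVEN `h(ℚ(P))`, `d = -54167`; k4-w2's `bsdp_two_433336a1_of_fukudaCertificate_pointField` displayed the two-conjunct `hcert`). Granted
`hLim2`; displayed: `ord₂ h(ℚ(θ, √2)) = ord₂ h(ℚ(θ))` (census `cyc3 = [2]`, `cyc6 = [2]`), `θ` any root of `X³ + (-1)X² + (-38)X + (-89)`. KERNEL: `ℚ(P) = ℚ(β) = ℚ(θ)`
(`β = -195 + (46)θ + (7)θ²` a root of the `2`-division cubic), Fukuda's index `0` from ONE prime above `2` (`2` inert: `existsUnique_two_mem_adjoin_of_odd`), Fukuda Thm. 1 (1) (`_holds`).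
[cite: Lim2017FineSelmer, §3 Thm. 3.5 and Lemma 3.2] [cite: Fukuda1994, Thm. 1 (1), p. 264] -/
theorem conjA_two_433336a1_of_fukudaLayers
    (hLim2 : Lim2017.thm35_at_two_fineSelmerDual_moduleFinite_of_classicalMuVanishes_of_le_divisionField_four)
    {θ : AlgebraicClosure ℚ} (hθ : aeval θ (Cubic.toPoly ⟨1, ((-1 : ℤ) : ℚ), ((-38 : ℤ) : ℚ), ((-89 : ℤ) : ℚ)⟩) = 0)
    (h01 : haveI : FiniteDimensional ℚ (IntermediateField.adjoin ℚ {θ}) :=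
        IntermediateField.adjoin.finiteDimensional ((AlgebraicClosure.isAlgebraic ℚ).isAlgebraic θ).isIntegral
      haveI : NumberField (IntermediateField.adjoin ℚ {θ}) := NumberField.mk
      ∀ κL : ZpExtension (IntermediateField.adjoin ℚ {θ}) 2, κL.IsCyclotomic → classNumberPExp κL 1 = classNumberPExp κL 0)
    (κ : ZpExtension ℚ 2) (hκ : κ.IsCyclotomic) :
    haveI := isElliptic_433336a1'
    ∃ (γ : absoluteGaloisGroup ℚ) (D : (⟨0, ((0 : ℤ) : ℚ), 0, ((-230659 : ℤ) : ℚ), ((-42638677 : ℤ) : ℚ)⟩ : WeierstrassCurve ℚ).FineSelmerDualData κ γ),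
      Module.Finite ℤ_[2] (RestrictScalars ℤ_[2] (IwasawaAlgebra 2) D.X) := by
  haveI := isElliptic_433336a1'
  have hθ' : θ ^ 3 + (-1 : AlgebraicClosure ℚ) * θ ^ 2 + (-38 : AlgebraicClosure ℚ) * θ + (-89 : AlgebraicClosure ℚ) = 0 := by
    have := hθ
    simp only [Cubic.toPoly, map_one, one_mul, aeval_add, aeval_mul, aeval_C, aeval_X_pow, aeval_X,
      eq_ratCast, Rat.cast_intCast] at this
    push_cast at this
    linear_combination this
  set β : AlgebraicClosure ℚ := algebraMap ℚ (AlgebraicClosure ℚ) (-195 : ℚ) +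
      algebraMap ℚ (AlgebraicClosure ℚ) (46 : ℚ) * θ + algebraMap ℚ (AlgebraicClosure ℚ) (7 : ℚ) * θ ^ 2 with hβdef
  have hβ : aeval β (Cubic.toPoly ⟨1, ((0 : ℤ) : ℚ), ((-230659 : ℤ) : ℚ), ((-42638677 : ℤ) : ℚ)⟩) = 0 := by
    simp only [Cubic.toPoly, map_one, one_mul, aeval_add, aeval_mul, aeval_C, aeval_X_pow, aeval_X, eq_ratCast,
      Rat.cast_intCast]
    rw [hβdef]
    simp only [eq_ratCast]
    push_cast
    linear_combination ((57023 : AlgebraicClosure ℚ) + (35910 : AlgebraicClosure ℚ) * θ + (7105 : AlgebraicClosure ℚ) * θ ^ 2 + (343 : AlgebraicClosure ℚ) * θ ^ 3) * hθ'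
  have hadj : IntermediateField.adjoin ℚ {β} = IntermediateField.adjoin ℚ {θ} := by
    apply le_antisymm
    · rw [IntermediateField.adjoin_simple_le_iff, hβdef]
      have hθmem := IntermediateField.mem_adjoin_simple_self ℚ θ
      exact add_mem (add_mem (algebraMap_mem _ _) (mul_mem (algebraMap_mem _ _) hθmem))
        (mul_mem (algebraMap_mem _ _) (pow_mem hθmem 2))
    · rw [IntermediateField.adjoin_simple_le_iff]
      have hθeq : θ = algebraMap ℚ (AlgebraicClosure ℚ) (1076409 : ℚ) +
          algebraMap ℚ (AlgebraicClosure ℚ) (1941 : ℚ) * β +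
          algebraMap ℚ (AlgebraicClosure ℚ) (-7 : ℚ) * β ^ 2 := by
        rw [hβdef]; simp only [eq_ratCast]; push_cast
        linear_combination ((4851 : AlgebraicClosure ℚ) + (343 : AlgebraicClosure ℚ) * θ) * hθ'
      rw [hθeq]
      have hβmem := IntermediateField.mem_adjoin_simple_self ℚ β
      exact add_mem (add_mem (algebraMap_mem _ _) (mul_mem (algebraMap_mem _ _) hβmem))
        (mul_mem (algebraMap_mem _ _) (pow_mem hβmem 2))
  obtain ⟨P₀, hP₀, hP₀eq⟩ := exists_geomTorsion_two_eq_some_root ((0 : ℤ) : ℚ) ((-230659 : ℤ) : ℚ)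
    ((-42638677 : ℤ) : ℚ) hβ
  have hF : IntermediateField.fixedField (MulAction.stabilizer (absoluteGaloisGroup ℚ) P₀) =
      IntermediateField.adjoin ℚ {θ} := by
    rw [fixedField_stabilizer_eq_adjoin_root _ _ _ hβ hP₀eq, ← hadj]
    -- the two `Algebra ℚ ℚ̄` instance paths agree
    congr 1
  have hirr := irreducible_cubic_d54167n
  exact fineSelmerDual_moduleFinite_two_of_totallyRamified_of_succ_eq_pointField hLim2 _ hP₀ hF
    (forall_totallyRamifiedFrom_zero_adjoin_of_existsUnique_two_mem (p := -1) (q := -38) (r := -89) hirr hθ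
      (existsUnique_two_mem_adjoin_of_odd (p := -1) (q := -38) (r := -89) (by decide) (by decide) hθ))
    h01 κ hκ

/-- The census curve `294104f1` is an elliptic curve. -/
theorem isElliptic_294104f1' : (⟨0, ((-1 : ℤ) : ℚ), 0, ((63420977 : ℤ) : ℚ), ((13288243896 : ℤ) : ℚ)⟩ : WeierstrassCurve ℚ).IsElliptic :=
  isElliptic_cubicModel _ _ _ (by simp only [Cubic.discr]; norm_num)

/-- **(A)₂ for `294104f1` from Fukuda's two-layer criterion with `n₀ = 0` DISCHARGED — ONE displayed numeric equality** (a `C1″-RES` row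
with EVEN `h(ℚ(P))`, `d = -36763`; k4-w2's `bsdp_two_294104f1_of_fukudaCertificate_pointField` displayed the two-conjunct `hcert`). Granted
`hLim2`; displayed: `ord₂ h(ℚ(θ, √2)) = ord₂ h(ℚ(θ))` (census `cyc3 = [2]`, `cyc6 = [6]`), `θ` any root of `X³ + (-1)X² + (-59)X + (-160)`. KERNEL: `ℚ(P) = ℚ(β) = ℚ(θ)`
(`β = 42248 + (5704)θ + (-1113)θ²` a root of the `2`-division cubic), Fukuda's index `0` from `2 ∤ disc = -36763` (`forall_totallyRamifiedFrom_zero_adjoin_of_odd_cubic_discr`), Fukuda Thm. 1 (1) (`_holds`).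
[cite: Lim2017FineSelmer, §3 Thm. 3.5 and Lemma 3.2] [cite: Fukuda1994, Thm. 1 (1), p. 264] -/
theorem conjA_two_294104f1_of_fukudaLayers
    (hLim2 : Lim2017.thm35_at_two_fineSelmerDual_moduleFinite_of_classicalMuVanishes_of_le_divisionField_four)
    {θ : AlgebraicClosure ℚ} (hθ : aeval θ (Cubic.toPoly ⟨1, ((-1 : ℤ) : ℚ), ((-59 : ℤ) : ℚ), ((-160 : ℤ) : ℚ)⟩) = 0)
    (h01 : haveI : FiniteDimensional ℚ (IntermediateField.adjoin ℚ {θ}) :=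
        IntermediateField.adjoin.finiteDimensional ((AlgebraicClosure.isAlgebraic ℚ).isAlgebraic θ).isIntegral
      haveI : NumberField (IntermediateField.adjoin ℚ {θ}) := NumberField.mk
      ∀ κL : ZpExtension (IntermediateField.adjoin ℚ {θ}) 2, κL.IsCyclotomic → classNumberPExp κL 1 = classNumberPExp κL 0)
    (κ : ZpExtension ℚ 2) (hκ : κ.IsCyclotomic) :
    haveI := isElliptic_294104f1'
    ∃ (γ : absoluteGaloisGroup ℚ) (D : (⟨0, ((-1 : ℤ) : ℚ), 0, ((63420977 : ℤ) : ℚ), ((13288243896 : ℤ) : ℚ)⟩ : WeierstrassCurve ℚ).FineSelmerDualData κ γ),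
      Module.Finite ℤ_[2] (RestrictScalars ℤ_[2] (IwasawaAlgebra 2) D.X) := by
  haveI := isElliptic_294104f1'
  have hθ' : θ ^ 3 + (-1 : AlgebraicClosure ℚ) * θ ^ 2 + (-59 : AlgebraicClosure ℚ) * θ + (-160 : AlgebraicClosure ℚ) = 0 := by
    have := hθ
    simp only [Cubic.toPoly, map_one, one_mul, aeval_add, aeval_mul, aeval_C, aeval_X_pow, aeval_X,
      eq_ratCast, Rat.cast_intCast] at this
    push_cast at this
    linear_combination this
  set β : AlgebraicClosure ℚ := algebraMap ℚ (AlgebraicClosure ℚ) (42248 : ℚ) +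
      algebraMap ℚ (AlgebraicClosure ℚ) (5704 : ℚ) * θ + algebraMap ℚ (AlgebraicClosure ℚ) (-1113 : ℚ) * θ ^ 2 with hβdef
  have hβ : aeval β (Cubic.toPoly ⟨1, ((-1 : ℤ) : ℚ), ((63420977 : ℤ) : ℚ), ((13288243896 : ℤ) : ℚ)⟩) = 0 := by
    simp only [Cubic.toPoly, map_one, one_mul, aeval_add, aeval_mul, aeval_C, aeval_X_pow, aeval_X, eq_ratCast,
      Rat.cast_intCast]
    rw [hβdef]
    simp only [eq_ratCast]
    push_cast
    linear_combination ((-488119334648 : AlgebraicClosure ℚ) + (-13158301149 : AlgebraicClosure ℚ) * θ + (19819065231 : AlgebraicClosure ℚ) * θ ^ 2 + (-1378749897 : AlgebraicClosure ℚ) * θ ^ 3) * hθ'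
  have hadj : IntermediateField.adjoin ℚ {β} = IntermediateField.adjoin ℚ {θ} := by
    apply le_antisymm
    · rw [IntermediateField.adjoin_simple_le_iff, hβdef]
      have hθmem := IntermediateField.mem_adjoin_simple_self ℚ θ
      exact add_mem (add_mem (algebraMap_mem _ _) (mul_mem (algebraMap_mem _ _) hθmem))
        (mul_mem (algebraMap_mem _ _) (pow_mem hθmem 2))
    · rw [IntermediateField.adjoin_simple_le_iff]
      have hθeq : θ = algebraMap ℚ (AlgebraicClosure ℚ) (48818549056/5280674083 : ℚ) +
          algebraMap ℚ (AlgebraicClosure ℚ) (120604/5280674083 : ℚ) * β +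
          algebraMap ℚ (AlgebraicClosure ℚ) (1113/5280674083 : ℚ) * β ^ 2 := by
        rw [hβdef]; simp only [eq_ratCast]; push_cast
        linear_combination (((12753126855 : AlgebraicClosure ℚ) / 5280674083) + ((-1378749897 : AlgebraicClosure ℚ) / 5280674083) * θ) * hθ'
      rw [hθeq]
      have hβmem := IntermediateField.mem_adjoin_simple_self ℚ β
      exact add_mem (add_mem (algebraMap_mem _ _) (mul_mem (algebraMap_mem _ _) hβmem))
        (mul_mem (algebraMap_mem _ _) (pow_mem hβmem 2))
  obtain ⟨P₀, hP₀, hP₀eq⟩ := exists_geomTorsion_two_eq_some_root ((-1 : ℤ) : ℚ) ((63420977 : ℤ) : ℚ)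
    ((13288243896 : ℤ) : ℚ) hβ
  have hF : IntermediateField.fixedField (MulAction.stabilizer (absoluteGaloisGroup ℚ) P₀) =
      IntermediateField.adjoin ℚ {θ} := by
    rw [fixedField_stabilizer_eq_adjoin_root _ _ _ hβ hP₀eq, ← hadj]
    -- the two `Algebra ℚ ℚ̄` instance paths agree
    congr 1
  have hirr := irreducible_cubic_d36763n
  exact fineSelmerDual_moduleFinite_two_of_totallyRamified_of_succ_eq_pointField hLim2 _ hP₀ hF
    (forall_totallyRamifiedFrom_zero_adjoin_of_odd_cubic_discr (p := -1) (q := -59) (r := -160) hirr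
      (by simp only [Cubic.discr]; norm_num) hθ)
    h01 κ hκ

end Summit.BirchSwinnertonDyer.BirchSwinnertonDyer.Theorems.AddKatoTwo

end
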